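import Literature.AlgebraicGeometry.ShimuraVarieties.UnitaryBallQuotientDatum
import Literature.Geometry.ComplexHyperbolic.UnitBallU21
import HarnessLib

/-!
# The real unitary group of a ball-quotient datum and its Sylvester frames

Topic `AlgebraicGeometry/ShimuraVarieties`; namespace
`Literature.AlgebraicGeometry.ShimuraVarieties` (generic lemmas in the grouping sub-namespace
`ConeChart`, datum API dotted on `UnitaryBallUniformisationDatum`). Everything here is a definition or a
PROVED lemma (Mathlib + tree).

For a complex hermitian matrix `Hc` the tree's `unitaryGroup (starRingEnd ℂ) Hc ≤ GL_m(ℂ)` is the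
real Lie group `U(Hc) = {g | gᴴ Hc g = Hc}` (`ConeChart.mem_unitaryGroup_conj_iff`); it acts on the
negative cone `negCone Hc` by `g • v = g v` (`ConeChart.mulAction`, continuous). For a ball-quotient
datum `D : UnitaryBallUniformisationDatum p X` (BMM Part 2 §§1.1–1.3):

* `D.realPoints = U(H^{τ₁})`, `D.toRealPoints : D.Γ →* D.realPoints` (through `τ₁`, injective), and
  `D.act γ v = D.toRealPoints γ • v` on the cone;
* for `p = 2`, a **Sylvester frame** `𝔣 : D.SylvesterFrame` (`Tᴴ H^{τ₁} T = J = diag(1,1,-1)`; one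
  exists by the field `signature_τ₁`, `nonempty_sylvesterFrame`) conjugates `D.realPoints` onto the
  tree's standard `U(2,1) = BallModel.U21` (`D.frameIso 𝔣 : D.realPoints ≃* U21`, `g ↦ T⁻¹ g T`,
  a homeomorphic isomorphism: `continuous_frameIso`, `continuous_frameIso_symm`), and
  `Q (T⁻¹ v) = ⟪v, v⟫` (`SylvesterFrame.Q_ti_mulVec`).

The ball chart of the cone built on a frame is in `UnitaryBallConeChart`.
-/

noncomputable section

open Matrix
open Literature.Geometry.ComplexHyperbolic
open Literature.Geometry.ComplexHyperbolic.BallModel (U21 Ball Q proj mat x₀)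

namespace Literature.AlgebraicGeometry.ShimuraVarieties

/-! ### The unitary group of a complex hermitian matrix and its action on the negative cone -/

namespace ConeChart

variable {m : Type*} [Fintype m] [DecidableEq m] {Hc : Matrix m m ℂ}

omit [Fintype m] [DecidableEq m] in
/-- `(g.map conj)ᵀ = gᴴ`. [folklore] -/
theorem transpose_map_starRingEnd (M : Matrix m m ℂ) : (M.map (starRingEnd ℂ))ᵀ = Mᴴ := by
  ext i j; simp [conjTranspose_apply]

/-- Membership in `U(Hc)`: `gᴴ Hc g = Hc`. [cite: BergeronMillsonMoeglin2016Balls, Part 2 §1.2] -/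
theorem mem_unitaryGroup_conj_iff {g : GL m ℂ} :
    g ∈ unitaryGroup (starRingEnd ℂ) Hc ↔ (g : Matrix m m ℂ)ᴴ * Hc * (g : Matrix m m ℂ) = Hc := by
  rw [mem_unitaryGroup_iff, transpose_map_starRingEnd]

omit [DecidableEq m] in
/-- `⟪g v, g v⟫ = ⟪v, v⟫`-type identity: `(g v)ᴴ Hc (g v) = vᴴ (gᴴ Hc g) v`. [folklore] -/
theorem star_mulVec_dotProduct (g : Matrix m m ℂ) (v : m → ℂ) :
    star (g *ᵥ v) ⬝ᵥ (Hc *ᵥ (g *ᵥ v)) = star v ⬝ᵥ ((gᴴ * Hc * g) *ᵥ v) := by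
  rw [star_mulVec, mulVec_mulVec, dotProduct_mulVec, vecMul_vecMul, ← Matrix.mul_assoc,
    ← dotProduct_mulVec]

/-- `U(Hc)` preserves the negative cone. [cite: BergeronMillsonMoeglin2016Balls, Part 2 §1.3] -/
theorem mulVec_mem_negCone {g : GL m ℂ} (hg : g ∈ unitaryGroup (starRingEnd ℂ) Hc) {v : m → ℂ}
    (hv : v ∈ negCone Hc) : (g : Matrix m m ℂ) *ᵥ v ∈ negCone Hc := by
  rw [mem_negCone_iff, star_mulVec_dotProduct, mem_unitaryGroup_conj_iff.mp hg]
  exact hv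

/-- The action of `U(Hc)` on the negative cone, `g • v = g v`.
[cite: BergeronMillsonMoeglin2016Balls, Part 2 §1.3] -/
instance mulAction : MulAction (unitaryGroup (starRingEnd ℂ) Hc) (negCone Hc) where
  smul g v := ⟨((g : GL m ℂ) : Matrix m m ℂ) *ᵥ (v : m → ℂ), mulVec_mem_negCone g.2 v.2⟩
  one_smul v := Subtype.ext (by
    change (((1 : unitaryGroup (starRingEnd ℂ) Hc) : GL m ℂ) : Matrix m m ℂ) *ᵥ (v : m → ℂ) = v
    simp)
  mul_smul g h v := Subtype.ext (by
    change (((g * h : unitaryGroup (starRingEnd ℂ) Hc) : GL m ℂ) : Matrix m m ℂ) *ᵥ (v : m → ℂ) =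
      ((g : GL m ℂ) : Matrix m m ℂ) *ᵥ (((h : GL m ℂ) : Matrix m m ℂ) *ᵥ (v : m → ℂ))
    rw [Subgroup.coe_mul, Units.val_mul, mulVec_mulVec])

/-- `↑(g • v) = g v`. [folklore] -/
@[simp] theorem coe_smul (g : unitaryGroup (starRingEnd ℂ) Hc) (v : negCone Hc) :
    ((g • v : negCone Hc) : m → ℂ) = ((g : GL m ℂ) : Matrix m m ℂ) *ᵥ (v : m → ℂ) := rfl

/-- The action on the cone is jointly continuous. [folklore] -/
instance continuousSMul : ContinuousSMul (unitaryGroup (starRingEnd ℂ) Hc) (negCone Hc) where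
  continuous_smul := by
    refine Continuous.subtype_mk ?_ _
    exact ((Units.continuous_val.comp (continuous_subtype_val.comp continuous_fst)).matrix_mulVec
      (continuous_subtype_val.comp continuous_snd))

end ConeChart

/-! ### The real points of a ball-quotient datum -/

namespace UnitaryBallUniformisationDatum

open Literature.AlgebraicGeometry.Motives (SchemeOver)

variable {p : ℕ} {X : SchemeOver ℂ} (D : UnitaryBallUniformisationDatum p X)

/-- The real Lie group `G_D = U(H^{τ₁}) = U(p,1) ≤ GL_{p+1}(ℂ)` of the datum.
[cite: BergeronMillsonMoeglin2016Balls, Part 2 §1.2] -/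
abbrev realPoints : Subgroup (GL (Fin (p + 1)) ℂ) := unitaryGroup (starRingEnd ℂ) D.Hℂ

/-- The matrix of `GL(τ₁) γ` is `γ^{τ₁}` (entrywise). [folklore] -/
theorem coe_generalLinearGroup_map (γ : GL (Fin (p + 1)) D.E) :
    ((Matrix.GeneralLinearGroup.map D.τ₁ γ : GL (Fin (p + 1)) ℂ) :
        Matrix (Fin (p + 1)) (Fin (p + 1)) ℂ) =
      ((γ : GL (Fin (p + 1)) D.E) : Matrix (Fin (p + 1)) (Fin (p + 1)) D.E).map D.τ₁ := rfl

/-- `U(V)(F) → U(H^{τ₁})` through `τ₁`, on `GL_{p+1}`.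
[cite: BergeronMillsonMoeglin2016Balls, Part 2 §1.2] -/
theorem map_τ₁_mem_realPoints {γ : GL (Fin (p + 1)) D.E}
    (hγ : γ ∈ unitaryGroup (conjRingHom D.E) D.H) :
    Matrix.GeneralLinearGroup.map D.τ₁ γ ∈ D.realPoints := by
  rw [ConeChart.mem_unitaryGroup_conj_iff, coe_generalLinearGroup_map]
  exact D.conjTranspose_mul_Hℂ_mul hγ

/-- **`Γ → G_D`**: the arithmetic group inside the real group, through `τ₁`.
[cite: BergeronMillsonMoeglin2016Balls, Part 2 §1.2] -/
def toRealPoints : D.Γ →* D.realPoints where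
  toFun γ := ⟨Matrix.GeneralLinearGroup.map D.τ₁ (γ : GL (Fin (p + 1)) D.E),
    D.map_τ₁_mem_realPoints (D.isCongruenceSubgroup.1 γ.2)⟩
  map_one' := Subtype.ext (by simp)
  map_mul' γ γ' := Subtype.ext (by simp)

/-- The matrix of `toRealPoints γ` is `γ^{τ₁}`. [folklore] -/
@[simp] theorem coe_toRealPoints (γ : D.Γ) :
    (((D.toRealPoints γ : D.realPoints) : GL (Fin (p + 1)) ℂ) :
        Matrix (Fin (p + 1)) (Fin (p + 1)) ℂ) =
      ((γ : GL (Fin (p + 1)) D.E) : Matrix (Fin (p + 1)) (Fin (p + 1)) D.E).map D.τ₁ := rfl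

/-- `Γ → G_D` is injective. [folklore] -/
theorem toRealPoints_injective : Function.Injective D.toRealPoints := by
  intro γ γ' h
  have h' := congrArg (fun g : D.realPoints ↦
    ((g : GL (Fin (p + 1)) ℂ) : Matrix (Fin (p + 1)) (Fin (p + 1)) ℂ)) h
  simp only [coe_toRealPoints] at h'
  exact Subtype.ext (Units.ext (Matrix.map_injective D.τ₁.injective h'))

/-- `D.act γ v = toRealPoints γ • v` on the cone. [folklore] -/
theorem coe_toRealPoints_smul (γ : D.Γ) (v : D.cone) :
    ((D.toRealPoints γ • v : D.cone) : Fin (p + 1) → ℂ) = D.act γ v := rfl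

/-! ### Sylvester frames (`p = 2`) -/

/-- The standard form of signature `(2,1)` is the tree's `J = diag(1,1,-1)`. [folklore] -/
theorem signatureMatrix_two : signatureMatrix 2 = BallModel.J := by
  ext i j
  fin_cases i <;> fin_cases j <;> simp [signatureMatrix, BallModel.J, Fin.last, Matrix.diagonal]

variable {X₂ : SchemeOver ℂ} (D₂ : UnitaryBallUniformisationDatum 2 X₂)

/-- A **Sylvester frame** of the datum: `T ∈ GL₃(ℂ)` with `Tᴴ H^{τ₁} T = diag(1,1,-1)` (an
isometry `(ℂ³, J) ≅ (V_{τ₁}, H)`; BMM Part 2 §1.1 "choosing a suitable isomorphism `V_τ ≅ ℂᵐ`").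
[cite: BergeronMillsonMoeglin2016Balls, Part 2 §1.1] -/
structure SylvesterFrame where
  /-- The frame matrix. -/
  T : GL (Fin 3) ℂ
  /-- `Tᴴ H^{τ₁} T = J`. -/
  conjTranspose_mul_mul : (T : Matrix (Fin 3) (Fin 3) ℂ)ᴴ * D₂.Hℂ * (T : Matrix (Fin 3) (Fin 3) ℂ) =
    BallModel.J

/-- Sylvester frames exist (field `signature_τ₁`).
[cite: BergeronMillsonMoeglin2016Balls, Part 2 §1.1] -/
theorem nonempty_sylvesterFrame : Nonempty D₂.SylvesterFrame := by
  obtain ⟨T, hT⟩ := D₂.signature_τ₁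
  exact ⟨⟨T, by rw [← signatureMatrix_two]; exact hT⟩⟩

namespace SylvesterFrame

variable {D₂} (𝔣 : D₂.SylvesterFrame)

/-- Notation-free access: the frame matrix `t` and its inverse `t⁻¹`. [folklore] -/
abbrev t : Matrix (Fin 3) (Fin 3) ℂ := (𝔣.T : Matrix (Fin 3) (Fin 3) ℂ)

/-- The inverse frame matrix. [folklore] -/
abbrev ti : Matrix (Fin 3) (Fin 3) ℂ := ((𝔣.T⁻¹ : GL (Fin 3) ℂ) : Matrix (Fin 3) (Fin 3) ℂ)

/-- `t t⁻¹ = 1`. [folklore] -/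
theorem t_mul_ti : 𝔣.t * 𝔣.ti = 1 := by
  rw [t, ti, ← Units.val_mul, mul_inv_cancel, Units.val_one]

/-- `t⁻¹ t = 1`. [folklore] -/
theorem ti_mul_t : 𝔣.ti * 𝔣.t = 1 := by
  rw [t, ti, ← Units.val_mul, inv_mul_cancel, Units.val_one]

/-- `H^{τ₁} = t⁻ᴴ J t⁻¹`. [folklore] -/
theorem Hℂ_eq : D₂.Hℂ = 𝔣.tiᴴ * BallModel.J * 𝔣.ti := by
  rw [← 𝔣.conjTranspose_mul_mul]
  calc D₂.Hℂ = (𝔣.t * 𝔣.ti)ᴴ * D₂.Hℂ * (𝔣.t * 𝔣.ti) := by rw [t_mul_ti]; simp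
    _ = 𝔣.tiᴴ * (𝔣.tᴴ * D₂.Hℂ * 𝔣.t) * 𝔣.ti := by
        rw [conjTranspose_mul]; simp only [Matrix.mul_assoc]

/-- The form in the frame: `(t⁻¹ v)ᴴ J (t⁻¹ v) = vᴴ H^{τ₁} v`, i.e. `Q (t⁻¹ v) = ⟪v, v⟫`.
[folklore] -/
theorem Q_ti_mulVec (v : Fin 3 → ℂ) :
    ((Q (𝔣.ti *ᵥ v) : ℝ) : ℂ) = star v ⬝ᵥ (D₂.Hℂ *ᵥ v) := by
  rw [← BallModel.form_eq_Q, ConeChart.star_mulVec_dotProduct, ← Hℂ_eq]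

/-- A cone vector has negative `Q` in the frame. [folklore] -/
theorem Q_ti_mulVec_neg {v : Fin 3 → ℂ} (hv : v ∈ D₂.cone) : Q (𝔣.ti *ᵥ v) < 0 := by
  have h := mem_negCone_iff.mp hv
  rwa [← 𝔣.Q_ti_mulVec, Complex.ofReal_re] at h

/-- Conjugation by the frame carries `G_D` into `U(2,1)`: `(t⁻¹ g t)ᴴ J (t⁻¹ g t) = J`.
[folklore] -/
theorem conj_mem_U21 {g : GL (Fin 3) ℂ} (hg : g ∈ D₂.realPoints) : 𝔣.T⁻¹ * g * 𝔣.T ∈ U21 := by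
  have hg' := ConeChart.mem_unitaryGroup_conj_iff.mp hg
  change ((𝔣.T⁻¹ * g * 𝔣.T : GL (Fin 3) ℂ) : Matrix (Fin 3) (Fin 3) ℂ)ᴴ * BallModel.J *
    ((𝔣.T⁻¹ * g * 𝔣.T : GL (Fin 3) ℂ) : Matrix (Fin 3) (Fin 3) ℂ) = BallModel.J
  rw [Units.val_mul, Units.val_mul, ← 𝔣.conjTranspose_mul_mul]
  change (𝔣.ti * (g : Matrix (Fin 3) (Fin 3) ℂ) * 𝔣.t)ᴴ * (𝔣.tᴴ * D₂.Hℂ * 𝔣.t) *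
    (𝔣.ti * (g : Matrix (Fin 3) (Fin 3) ℂ) * 𝔣.t) = 𝔣.tᴴ * D₂.Hℂ * 𝔣.t
  calc (𝔣.ti * (g : Matrix (Fin 3) (Fin 3) ℂ) * 𝔣.t)ᴴ * (𝔣.tᴴ * D₂.Hℂ * 𝔣.t) *
        (𝔣.ti * (g : Matrix (Fin 3) (Fin 3) ℂ) * 𝔣.t)
      = 𝔣.tᴴ * (g : Matrix (Fin 3) (Fin 3) ℂ)ᴴ * ((𝔣.t * 𝔣.ti)ᴴ * D₂.Hℂ * (𝔣.t * 𝔣.ti)) *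
          (g : Matrix (Fin 3) (Fin 3) ℂ) * 𝔣.t := by
        simp only [conjTranspose_mul, Matrix.mul_assoc]
    _ = 𝔣.tᴴ * ((g : Matrix (Fin 3) (Fin 3) ℂ)ᴴ * D₂.Hℂ * (g : Matrix (Fin 3) (Fin 3) ℂ)) *
          𝔣.t := by
        rw [t_mul_ti, conjTranspose_one, Matrix.one_mul, Matrix.mul_one]
        simp only [Matrix.mul_assoc]
    _ = 𝔣.tᴴ * D₂.Hℂ * 𝔣.t := by rw [hg', Matrix.mul_assoc]

/-- Conversely `t h t⁻¹ ∈ G_D` for `h ∈ U(2,1)`. [folklore] -/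
theorem conj_symm_mem_realPoints {h : GL (Fin 3) ℂ} (hh : h ∈ U21) :
    𝔣.T * h * 𝔣.T⁻¹ ∈ D₂.realPoints := by
  have hh' : (h : Matrix (Fin 3) (Fin 3) ℂ)ᴴ * BallModel.J * (h : Matrix (Fin 3) (Fin 3) ℂ) =
    BallModel.J := hh
  rw [ConeChart.mem_unitaryGroup_conj_iff, Units.val_mul, Units.val_mul, 𝔣.Hℂ_eq]
  change (𝔣.t * (h : Matrix (Fin 3) (Fin 3) ℂ) * 𝔣.ti)ᴴ * (𝔣.tiᴴ * BallModel.J * 𝔣.ti) *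
    (𝔣.t * (h : Matrix (Fin 3) (Fin 3) ℂ) * 𝔣.ti) = 𝔣.tiᴴ * BallModel.J * 𝔣.ti
  calc (𝔣.t * (h : Matrix (Fin 3) (Fin 3) ℂ) * 𝔣.ti)ᴴ * (𝔣.tiᴴ * BallModel.J * 𝔣.ti) *
        (𝔣.t * (h : Matrix (Fin 3) (Fin 3) ℂ) * 𝔣.ti)
      = 𝔣.tiᴴ * (h : Matrix (Fin 3) (Fin 3) ℂ)ᴴ * ((𝔣.ti * 𝔣.t)ᴴ * BallModel.J * (𝔣.ti * 𝔣.t)) *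
          (h : Matrix (Fin 3) (Fin 3) ℂ) * 𝔣.ti := by
        simp only [conjTranspose_mul, Matrix.mul_assoc]
    _ = 𝔣.tiᴴ * ((h : Matrix (Fin 3) (Fin 3) ℂ)ᴴ * BallModel.J * (h : Matrix (Fin 3) (Fin 3) ℂ)) *
          𝔣.ti := by
        rw [ti_mul_t, conjTranspose_one, Matrix.one_mul, Matrix.mul_one]
        simp only [Matrix.mul_assoc]
    _ = 𝔣.tiᴴ * BallModel.J * 𝔣.ti := by rw [hh', Matrix.mul_assoc]

/-- The image of `G_D` under conjugation by the frame is exactly `U(2,1)`. [folklore] -/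
theorem map_realPoints_eq :
    D₂.realPoints.map (MulAut.conj 𝔣.T⁻¹).toMonoidHom = U21 := by
  ext h
  simp only [Subgroup.mem_map, MulEquiv.coe_toMonoidHom, MulAut.conj_apply, inv_inv]
  constructor
  · rintro ⟨g, hg, rfl⟩
    exact 𝔣.conj_mem_U21 hg
  · intro hh
    exact ⟨𝔣.T * h * 𝔣.T⁻¹, 𝔣.conj_symm_mem_realPoints hh, by group⟩

end SylvesterFrame

/-- **`G_D ≅ U(2,1)`** by conjugation with a Sylvester frame, `g ↦ T⁻¹ g T`.
[cite: BergeronMillsonMoeglin2016Balls, Part 2 §1.1] -/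
def frameIso (𝔣 : D₂.SylvesterFrame) : D₂.realPoints ≃* U21 :=
  ((MulAut.conj 𝔣.T⁻¹).subgroupMap D₂.realPoints).trans (MulEquiv.subgroupCongr 𝔣.map_realPoints_eq)

/-- The matrix of `frameIso g` is `t⁻¹ g t`. [folklore] -/
@[simp] theorem coe_frameIso (𝔣 : D₂.SylvesterFrame) (g : D₂.realPoints) :
    ((D₂.frameIso 𝔣 g : U21) : GL (Fin 3) ℂ) = 𝔣.T⁻¹ * g * 𝔣.T := by
  change 𝔣.T⁻¹ * (g : GL (Fin 3) ℂ) * (𝔣.T⁻¹)⁻¹ = _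
  rw [inv_inv]

/-- `mat (frameIso g) = t⁻¹ g t` as matrices. [folklore] -/
theorem mat_frameIso (𝔣 : D₂.SylvesterFrame) (g : D₂.realPoints) :
    mat (D₂.frameIso 𝔣 g) = 𝔣.ti * ((g : GL (Fin 3) ℂ) : Matrix (Fin 3) (Fin 3) ℂ) * 𝔣.t := by
  rw [mat, coe_frameIso, Units.val_mul, Units.val_mul]

/-- `frameIso` is continuous. [folklore] -/
theorem continuous_frameIso (𝔣 : D₂.SylvesterFrame) : Continuous (D₂.frameIso 𝔣) := by
  rw [Topology.IsInducing.subtypeVal.continuous_iff]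
  exact ((continuous_const.mul continuous_subtype_val).mul continuous_const).congr
    fun g ↦ (D₂.coe_frameIso 𝔣 g).symm

/-- `frameIso⁻¹` is continuous. [folklore] -/
theorem continuous_frameIso_symm (𝔣 : D₂.SylvesterFrame) : Continuous (D₂.frameIso 𝔣).symm := by
  have h : ∀ u : U21, (((D₂.frameIso 𝔣).symm u : D₂.realPoints) : GL (Fin 3) ℂ) =
      𝔣.T * u * 𝔣.T⁻¹ := fun u ↦ by
    have := D₂.coe_frameIso 𝔣 ((D₂.frameIso 𝔣).symm u)
    rw [MulEquiv.apply_symm_apply] at this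
    rw [this]; group
  rw [Topology.IsInducing.subtypeVal.continuous_iff]
  exact ((continuous_const.mul continuous_subtype_val).mul continuous_const).congr
    fun u ↦ (h u).symm

end UnitaryBallUniformisationDatum

end Literature.AlgebraicGeometry.ShimuraVarieties

end
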